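import Summits.MatrixMultiplication.MatrixMultiplication.Theorems.SoloInformedShiftSigns

/-!
# The spread translate world has rank ≥ n³/3 (THEOREM 8.21, kernel form)

This work, §8.8 (T13)(b) / paper `C3-m2.md` §4 (gen 107). Setting of `SoloInformedTranslateWorld`: a CU13-Def-12
realization of `⟨n,n,n⟩` in `𝒮(S⁰ × S¹, ±)`, coprime case (`S¹ = G` of odd order, no 2-torsion `hG`), an arbitrary
chart `Φ` into `S⁰ = G₀`, full separation, a class map `κ : G → R` (`r = |R|`) [CohnUmans2013, arXiv:1207.6528, Def. 12].

`Data.cube_le_three_mul_of_spread` — THEOREM 8.21: if every column of `a` and every row of `b` is LOCKED to the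
column / row `j₀` (`a(i,j) ∼ a(i,j₀) ± t_j`, `b(j,k) ∼ b(j₀,k) ± t_j`) and the class multiplicities of `f = a(·,j₀)` and
`l = b(j₀,·)` are `≤ μ` with `10 μ < n`, then `n³ ≤ 3 · r · |S⁰|`.

Proof (all in the kernel): Boolean signs `ε, δ`; for each column `j` with `t_j ≠ 0` the shift rule read at the
non-degenerate good cells of the pair `(j₁, j)` (`SoloInformedShiftSigns.beq_eq_beq_of_shift`) and the counting lemma
(`exists_const_of_antiAligned'`, bad sets `≤ 4μ` per row and column) make the sign products constant; the gauge
`f' = -ε₁ f`, `l' = δ₁ l`, `g_j = ∓ t_j` then makes `a ∼ f' + g`, `b ∼ l' - g` EXACT translates; finally either a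
level set of `g` has `≥ n/3` columns (`Data.sq_mul_card_le_of_level`) or `g` takes three values
(`Data.cube_le_two_mul_of_locked_three`). Together with exact locking from a doubly-rich column
(`SoloInformedCrossStar.Data.locked_of_cross_rich`) this is case (α1) of THEOREM 8.22 (= CONJECTURE C3, m = 2 coprime).
References: this work §8.8 (T13); CohnUmans2013 Def. 12.
-/

namespace Summit.MatrixMultiplication.MatrixMultiplication.Theorems.TwistedTPP

namespace FibreLines

variable {ι G : Type*} [AddCommGroup G]

/-! ### Pointwise helpers -/

/-- Row form of a column coincidence: `f ∼ l + t` gives `l ∼ f - t` or `l ∼ f + t`. -/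
theorem signEq_row_of_col_add {f l t : G} (h : SignEq f (l + t)) : SignEq l (f - t) ∨ SignEq l (f + t) := by
  rcases h with rfl | rfl
  · exact Or.inl (Or.inl (by abel))
  · exact Or.inr (Or.inr (by abel))

/-- Row form of a column coincidence: `f ∼ l - t` gives `l ∼ f + t` or `l ∼ f - t`. -/
theorem signEq_row_of_col_sub {f l t : G} (h : SignEq f (l - t)) : SignEq l (f + t) ∨ SignEq l (f - t) := by
  rcases h with rfl | rfl
  · exact Or.inl (Or.inl (by abel))
  · exact Or.inr (Or.inr (by abel))

/-- Gauge identity for `a`, aligned case. -/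
theorem gauge_a_same (ε₁ : Bool) (f t : G) : SignEq (f + sgn ε₁ t) (sgn (!ε₁) f + -t) := by
  cases ε₁
  · simp only [sgn_false, Bool.not_false, sgn_true]; exact Or.inl rfl
  · simp only [sgn_true, Bool.not_true, sgn_false]; exact Or.inr (by abel)

/-- Gauge identity for `a`, anti-aligned case. -/
theorem gauge_a_opp (ε₁ : Bool) (f t : G) : SignEq (f + sgn (!ε₁) t) (sgn (!ε₁) f + t) := by
  cases ε₁
  · simp only [Bool.not_false, sgn_true]; exact Or.inl rfl
  · simp only [Bool.not_true, sgn_false]; exact Or.inr (by abel)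

/-- Gauge identity for `b`, aligned case. -/
theorem gauge_b_same (δ₁ : Bool) (l t : G) : SignEq (l + sgn δ₁ t) (sgn δ₁ l - -t) := by
  cases δ₁
  · simp only [sgn_false]; exact Or.inr (by abel)
  · simp only [sgn_true]; exact Or.inl (by abel)

/-- Gauge identity for `b`, anti-aligned case. -/
theorem gauge_b_opp (δ₁ : Bool) (l t : G) : SignEq (l + sgn (!δ₁) t) (sgn δ₁ l - t) := by
  cases δ₁
  · simp only [Bool.not_false, sgn_true, sgn_false]; exact Or.inr (by abel)
  · simp only [Bool.not_true, sgn_false, sgn_true]; exact Or.inl (by abel)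

/-- Reading a Boolean equality test. -/
theorem beq_cases {a b e : Bool} (h : (a == b) = e) : (e = true ∧ b = a) ∨ (e = false ∧ b = !a) := by
  cases a <;> cases b <;> cases e <;> simp_all

/-! ### THEOREM 8.21 -/

/-- **THEOREM 8.21 (spread translate world).** Locked columns and rows with spread base column / row force
`n³ ≤ 3 · r · |S⁰|`. [this work, §8.8 (T13)(b); `C3-m2.md` §4] -/
theorem Data.cube_le_three_mul_of_spread [Fintype ι] [DecidableEq ι] {G₀ : Type*} [AddCommGroup G₀] [Fintype G₀]
    [DecidableEq G₀] [Fintype G] [DecidableEq G] {R : Type*} [Fintype R] [DecidableEq R]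
    (hG : ∀ x : G, x = -x → x = 0) (D : Data ι G) (Φ : Chart ι G₀) (κ : G → R)
    (hκ : ∀ x y, κ x = κ y → SignEq x y) (hsep : D.SepAll Φ) (j₀ : ι) (t : ι → G)
    (ha : ∀ i j, SignEq (D.a i j) (D.a i j₀ + t j) ∨ SignEq (D.a i j) (D.a i j₀ - t j))
    (hb : ∀ j k, SignEq (D.b j k) (D.b j₀ k + t j) ∨ SignEq (D.b j k) (D.b j₀ k - t j))
    (μ : ℕ) (hn : 10 * μ < Fintype.card ι)
    (hfμ : ∀ v : G, (Finset.univ.filter fun i => D.a i j₀ = v ∨ D.a i j₀ = -v).card ≤ μ)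
    (hlμ : ∀ v : G, (Finset.univ.filter fun k => D.b j₀ k = v ∨ D.b j₀ k = -v).card ≤ μ) :
    Fintype.card ι ^ 3 ≤ 3 * (Fintype.card R * Fintype.card G₀) := by
  classical
  -- (L1), (L2): after a gauge, `a` and `b` are exact translates
  obtain ⟨f, g, l, ha', hb'⟩ : ∃ f g l : ι → G,
      (∀ i j, SignEq (D.a i j) (f i + g j)) ∧ (∀ j k, SignEq (D.b j k) (l k - g j)) := by
    -- Boolean signs
    obtain ⟨ε, hε⟩ : ∃ ε : ι → ι → Bool, ∀ i j, SignEq (D.a i j) (D.a i j₀ + sgn (ε i j) (t j)) := by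
      refine ⟨fun i j => decide (SignEq (D.a i j) (D.a i j₀ + t j)), fun i j => ?_⟩
      beta_reduce
      by_cases h : SignEq (D.a i j) (D.a i j₀ + t j)
      · rw [decide_eq_true h, sgn_true]; exact h
      · rw [decide_eq_false h, sgn_false, ← sub_eq_add_neg]; exact (ha i j).resolve_left h
    obtain ⟨δ, hδ⟩ : ∃ δ : ι → ι → Bool, ∀ j k, SignEq (D.b j k) (D.b j₀ k + sgn (δ j k) (t j)) := by
      refine ⟨fun j k => decide (SignEq (D.b j k) (D.b j₀ k + t j)), fun j k => ?_⟩
      beta_reduce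
      by_cases h : SignEq (D.b j k) (D.b j₀ k + t j)
      · rw [decide_eq_true h, sgn_true]; exact h
      · rw [decide_eq_false h, sgn_false, ← sub_eq_add_neg]; exact (hb j k).resolve_left h
    by_cases hT : ∀ j, t j = 0
    · refine ⟨fun i => D.a i j₀, fun _ => 0, fun k => D.b j₀ k, fun i j => ?_, fun j k => ?_⟩
      · simpa [hT j, sgn_zero] using hε i j
      · simpa [hT j, sgn_zero] using hδ j k
    push Not at hT
    obtain ⟨j₁, hj₁⟩ := hT
    -- degenerate rows / columns
    obtain ⟨Ideg, hIdeg⟩ : ∃ S : Finset ι, ∀ i, i ∉ S ↔ D.a i j₀ ≠ 0 :=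
      ⟨Finset.univ.filter fun i => D.a i j₀ = 0, fun i => by simp⟩
    obtain ⟨Kdeg, hKdeg⟩ : ∃ S : Finset ι, ∀ k, k ∉ S ↔ D.b j₀ k ≠ 0 :=
      ⟨Finset.univ.filter fun k => D.b j₀ k = 0, fun k => by simp⟩
    have hI : Ideg.card ≤ μ := by
      refine le_trans (Finset.card_le_card ?_) (hfμ 0)
      intro i hi
      simp only [Finset.mem_filter, Finset.mem_univ, true_and, neg_zero, or_self]
      by_contra h; exact (hIdeg i).mpr h hi
    have hK : Kdeg.card ≤ μ := by
      refine le_trans (Finset.card_le_card ?_) (hlμ 0)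
      intro k hk
      simp only [Finset.mem_filter, Finset.mem_univ, true_and, neg_zero, or_self]
      by_contra h; exact (hKdeg k).mpr h hk
    -- sign consistency for every column `j` with `t j ≠ 0`
    have hcons : ∀ j, ∃ e : Bool, t j ≠ 0 →
        (∀ i, D.a i j₀ ≠ 0 → (ε i j₁ == ε i j) = e) ∧ (∀ k, D.b j₀ k ≠ 0 → (δ j₁ k == δ j k) = e) := by
      intro j
      by_cases htj : t j = 0
      · exact ⟨true, fun h => absurd htj h⟩
      -- the bad relation of the pair `(j₁, j)`
      obtain ⟨Bad, hBad⟩ : ∃ Bad : ι → ι → Prop, ∀ i k, Bad i k ↔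
          (SignEq (D.a i j₀) (D.b j₀ k + t j₁) ∨ SignEq (D.a i j₀) (D.b j₀ k - t j₁) ∨
            SignEq (D.a i j₀) (D.b j₀ k + t j) ∨ SignEq (D.a i j₀) (D.b j₀ k - t j)) :=
        ⟨_, fun _ _ => Iff.rfl⟩
      have hcol : ∀ k, k ∉ Kdeg → ((Finset.univ \ Ideg).filter (fun i => Bad i k)).card ≤ 4 * μ := by
        intro k _
        calc ((Finset.univ \ Ideg).filter (fun i => Bad i k)).card
            ≤ ((Finset.univ.filter fun i => D.a i j₀ = D.b j₀ k + t j₁ ∨ D.a i j₀ = -(D.b j₀ k + t j₁)) ∪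
                (Finset.univ.filter fun i => D.a i j₀ = D.b j₀ k - t j₁ ∨ D.a i j₀ = -(D.b j₀ k - t j₁)) ∪
                (Finset.univ.filter fun i => D.a i j₀ = D.b j₀ k + t j ∨ D.a i j₀ = -(D.b j₀ k + t j)) ∪
                (Finset.univ.filter fun i => D.a i j₀ = D.b j₀ k - t j ∨ D.a i j₀ = -(D.b j₀ k - t j))).card := by
              apply Finset.card_le_card
              intro i hi
              simp only [Finset.mem_filter, Finset.mem_sdiff, Finset.mem_univ, true_and,
                Finset.mem_union] at hi ⊢
              rcases (hBad i k).mp hi.2 with h | h | h | h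
              · exact Or.inl (Or.inl (Or.inl h))
              · exact Or.inl (Or.inl (Or.inr h))
              · exact Or.inl (Or.inr h)
              · exact Or.inr h
          _ ≤ μ + μ + μ + μ := by
              refine (Finset.card_union_le _ _).trans ?_
              refine (Nat.add_le_add_right (Finset.card_union_le _ _) _).trans ?_
              refine (Nat.add_le_add_right (Nat.add_le_add_right (Finset.card_union_le _ _) _) _).trans ?_
              have := hfμ (D.b j₀ k + t j₁); have := hfμ (D.b j₀ k - t j₁)
              have := hfμ (D.b j₀ k + t j); have := hfμ (D.b j₀ k - t j); omega
          _ = 4 * μ := by ring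
      have hrow : ∀ i, i ∉ Ideg → ((Finset.univ \ Kdeg).filter (fun k => Bad i k)).card ≤ 4 * μ := by
        intro i _
        calc ((Finset.univ \ Kdeg).filter (fun k => Bad i k)).card
            ≤ ((Finset.univ.filter fun k => D.b j₀ k = D.a i j₀ - t j₁ ∨ D.b j₀ k = -(D.a i j₀ - t j₁)) ∪
                (Finset.univ.filter fun k => D.b j₀ k = D.a i j₀ + t j₁ ∨ D.b j₀ k = -(D.a i j₀ + t j₁)) ∪
                (Finset.univ.filter fun k => D.b j₀ k = D.a i j₀ - t j ∨ D.b j₀ k = -(D.a i j₀ - t j)) ∪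
                (Finset.univ.filter fun k => D.b j₀ k = D.a i j₀ + t j ∨ D.b j₀ k = -(D.a i j₀ + t j))).card := by
              apply Finset.card_le_card
              intro k hk
              simp only [Finset.mem_filter, Finset.mem_sdiff, Finset.mem_univ, true_and,
                Finset.mem_union] at hk ⊢
              rcases (hBad i k).mp hk.2 with h | h | h | h
              · rcases signEq_row_of_col_add h with h' | h'
                · exact Or.inl (Or.inl (Or.inl h'))
                · exact Or.inl (Or.inl (Or.inr h'))
              · rcases signEq_row_of_col_sub h with h' | h'
                · exact Or.inl (Or.inl (Or.inr h'))
                · exact Or.inl (Or.inl (Or.inl h'))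
              · rcases signEq_row_of_col_add h with h' | h'
                · exact Or.inl (Or.inr h')
                · exact Or.inr h'
              · rcases signEq_row_of_col_sub h with h' | h'
                · exact Or.inr h'
                · exact Or.inl (Or.inr h')
          _ ≤ μ + μ + μ + μ := by
              refine (Finset.card_union_le _ _).trans ?_
              refine (Nat.add_le_add_right (Finset.card_union_le _ _) _).trans ?_
              refine (Nat.add_le_add_right (Nat.add_le_add_right (Finset.card_union_le _ _) _) _).trans ?_
              have := hlμ (D.a i j₀ - t j₁); have := hlμ (D.a i j₀ + t j₁)
              have := hlμ (D.a i j₀ - t j); have := hlμ (D.a i j₀ + t j); omega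
          _ = 4 * μ := by ring
      -- anti-alignment of `ε₁ == ε` and `!(δ₁ == δ)` at the non-degenerate good cells
      have hanti : ∀ i, i ∉ Ideg → ∀ k, k ∉ Kdeg → ¬ Bad i k →
          (fun i => (ε i j₁ == ε i j)) i ≠ (fun k => !(δ j₁ k == δ j k)) k := by
        intro i hi k hk hbad
        have hf := (hIdeg i).mp hi
        have hl := (hKdeg k).mp hk
        have hb4 : ¬ (SignEq (D.a i j₀) (D.b j₀ k + t j₁) ∨ SignEq (D.a i j₀) (D.b j₀ k - t j₁) ∨
            SignEq (D.a i j₀) (D.b j₀ k + t j) ∨ SignEq (D.a i j₀) (D.b j₀ k - t j)) :=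
          fun h => hbad ((hBad i k).mpr h)
        have E := beq_eq_beq_of_shift hG hf hl (ε i j₁) (δ j₁ k) (ε i j) (δ j k) (D.adm_eqn i j₀ k)
          (((D.adm_eqn i j₁ k).of_signEq_left (hε i j₁)).of_signEq_mid (hδ j₁ k))
          (((D.adm_eqn i j k).of_signEq_left (hε i j)).of_signEq_mid (hδ j k)) hj₁ htj
          (fun h => hb4 (h.elim Or.inl fun h => Or.inr (Or.inl h)))
          (fun h => hb4 (h.elim (fun h => Or.inr (Or.inr (Or.inl h))) fun h => Or.inr (Or.inr (Or.inr h))))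
        show (ε i j₁ == ε i j) ≠ !(δ j₁ k == δ j k)
        rw [E]
        cases (δ j₁ k == δ j k) <;> decide
      obtain ⟨e, he₁, he₂⟩ := exists_const_of_antiAligned' μ (4 * μ) (4 * μ) (by omega) (by omega)
        Ideg Kdeg hI hK Bad hcol hrow (fun i => (ε i j₁ == ε i j)) (fun k => !(δ j₁ k == δ j k)) hanti
      refine ⟨e, fun _ => ⟨fun i hi => he₁ i ((hIdeg i).mpr hi), fun k hk => ?_⟩⟩
      have h := he₂ k ((hKdeg k).mpr hk)
      revert h
      cases (δ j₁ k == δ j k) <;> cases e <;> simp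
    choose e he using hcons
    -- the gauge `f' = -ε₁ f`, `l' = δ₁ l`, `g = ∓ t`
    refine ⟨fun i => sgn (!(ε i j₁)) (D.a i j₀), fun j => if e j then -(t j) else t j,
      fun k => sgn (δ j₁ k) (D.b j₀ k), fun i j => ?_, fun j k => ?_⟩
    · -- (L1)
      show SignEq (D.a i j) (sgn (!(ε i j₁)) (D.a i j₀) + (if e j then -(t j) else t j))
      by_cases htj : t j = 0
      · have h := hε i j
        rw [htj, sgn_zero, add_zero] at h
        rw [htj, neg_zero, ite_self, add_zero]
        exact h.trans (signEq_sgn _ _).symm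
      by_cases hfi : D.a i j₀ = 0
      · have h := hε i j
        rw [hfi, zero_add] at h
        rw [hfi, sgn_zero, zero_add]
        have h' : SignEq (D.a i j) (t j) := h.trans (signEq_sgn _ _)
        split_ifs
        · exact signEq_neg_right.mpr h'
        · exact h'
      · obtain ⟨hεe, -⟩ := he j htj
        rcases beq_cases (hεe i hfi) with ⟨hej, hεij⟩ | ⟨hej, hεij⟩
        · rw [if_pos hej]
          have h := hε i j
          rw [hεij] at h
          exact h.trans (gauge_a_same _ _ _)
        · rw [if_neg (by rw [hej]; decide)]
          have h := hε i j
          rw [hεij] at h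
          exact h.trans (gauge_a_opp _ _ _)
    · -- (L2)
      show SignEq (D.b j k) (sgn (δ j₁ k) (D.b j₀ k) - (if e j then -(t j) else t j))
      by_cases htj : t j = 0
      · have h := hδ j k
        rw [htj, sgn_zero, add_zero] at h
        rw [htj, neg_zero, ite_self, sub_zero]
        exact h.trans (signEq_sgn _ _).symm
      by_cases hlk : D.b j₀ k = 0
      · have h := hδ j k
        rw [hlk, zero_add] at h
        rw [hlk, sgn_zero, zero_sub]
        have h' : SignEq (D.b j k) (t j) := h.trans (signEq_sgn _ _)
        split_ifs
        · rw [neg_neg]; exact h'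
        · exact signEq_neg_right.mpr h'
      · obtain ⟨-, hδe⟩ := he j htj
        rcases beq_cases (hδe k hlk) with ⟨hej, hδjk⟩ | ⟨hej, hδjk⟩
        · rw [if_pos hej]
          have h := hδ j k
          rw [hδjk] at h
          exact h.trans (gauge_b_same _ _ _)
        · rw [if_neg (by rw [hej]; decide)]
          have h := hδ j k
          rw [hδjk] at h
          exact h.trans (gauge_b_opp _ _ _)
  -- dichotomy on the level sets of `g`
  have hpos : 0 < Fintype.card ι := by omega
  by_cases hbig : ∃ γ : G, Fintype.card ι ≤ 3 * (Finset.univ.filter fun j => g j = γ).card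
  · obtain ⟨γ, hγ⟩ := hbig
    have h := D.sq_mul_card_le_of_level Φ κ hκ hsep g l hb' (Finset.univ.filter fun j => g j = γ) (by
      intro j hj j' hj'
      simp only [Finset.mem_filter, Finset.mem_univ, true_and] at hj hj'
      rw [hj, hj'])
    calc Fintype.card ι ^ 3 = Fintype.card ι ^ 2 * Fintype.card ι := by ring
      _ ≤ Fintype.card ι ^ 2 * (3 * (Finset.univ.filter fun j => g j = γ).card) := Nat.mul_le_mul_left _ hγ
      _ = 3 * (Fintype.card ι ^ 2 * (Finset.univ.filter fun j => g j = γ).card) := by ring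
      _ ≤ 3 * (Fintype.card R * Fintype.card G₀) := Nat.mul_le_mul_left _ h
  · push Not at hbig
    obtain ⟨ja⟩ := Fintype.card_pos_iff.mp hpos
    obtain ⟨jb, hjb⟩ := exists_notMem_of_card_le (Finset.univ.filter fun j => g j = g ja) le_rfl
      (by have := hbig (g ja); omega)
    have hab : g ja ≠ g jb := by
      intro h; apply hjb; simp [h]
    obtain ⟨jc, hjc⟩ := exists_notMem_of_card_le
      ((Finset.univ.filter fun j => g j = g ja) ∪ (Finset.univ.filter fun j => g j = g jb))
      (Finset.card_union_le _ _) (by have := hbig (g ja); have := hbig (g jb); omega)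
    simp only [Finset.mem_union, Finset.mem_filter, Finset.mem_univ, true_and, not_or] at hjc
    have hac : g ja ≠ g jc := fun h => hjc.1 h.symm
    have hbc : g jb ≠ g jc := fun h => hjc.2 h.symm
    calc Fintype.card ι ^ 3 ≤ 2 * (Fintype.card R * Fintype.card G₀) :=
          D.cube_le_two_mul_of_locked_three hG Φ κ hκ hsep f g l ha' hb' hab hac hbc
      _ ≤ 3 * (Fintype.card R * Fintype.card G₀) := by omega

end FibreLines

end Summit.MatrixMultiplication.MatrixMultiplication.Theorems.TwistedTPP
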